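import Summits.QuantumFields.YangMills.Theorems.FluctuationComparisonRegPrIntLS2BetaCoupledWordSquare
import Summits.QuantumFields.YangMills.Theorems.FluctuationComparisonRegPrIntLS2BetaPlaquetteWordLoopForm
import Literature.MathematicalPhysics.QuantumFieldTheory.Balaban1983to89.BlockAveragingPlaquetteBound
import Literature.MathematicalPhysics.QuantumFieldTheory.Balaban1983to89.BlockAveragingFederbush
import HarnessLib

/-!
# S2β · `hFlat` road, UV3-NODE §57.8 (C) ∕ §64.2 — LETTERS FOR THE (C)-STEP: the small-loop average as `exp[mean log]` on the guard, the `dist1 ↔ log` conversions with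
# `1 + O(t)` constants, the log of a unitary conjugate, the square at a corner, and the member word at the chain indices as the conjugated sharp square

Cell `ym3-torus` (rung R3 = continuum `SU(2)` Yang–Mills on the three-torus — NOT d = 4, NOT infinite volume, NOT a mass gap, NOT Clay).
Width seat «width 10» `ym3-torus-px10` (gen 22), FREE px helper on crux `stmt-QuantumFields-20520`, count-neutral, DEFINITION-FREE; pen «(C)-STEP» named by px8 g21 (08:11:35Z).
* §1 `coe_avg_eq_exp_mean` (lit `coe_ESU_of_small`∕`eml_eq_exp` through `LoopAverage.avg`'s enumeration: `(expMeanLogSU.avg W : M_N) = exp(|I|⁻¹ • Σ log W_i)` with the REAL scalar),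
  `norm_mean_le_mean`, `norm_mlog_conj_eq` (`‖log (S X S⁻¹)‖ = ‖log X‖`, `S ∈ SU(N)`), `div_one_sub_le` (the model's `dist1 = ‖· − 1‖` is lit ✓`FederbushMean.dist1_SU_eq`), ★`norm_mlog_le_one_add_mul` (lit (26): `‖X − 1‖ ≤ t ≤ ½ ⟹
  ‖log X‖ ≤ (1 + 2t)‖X − 1‖` — the conversion costs `1 + O(t)`, NOT `π∕2`), ★`norm_sub_one_le_one_add_mul` (lit (27) + Mathlib `|eˣ − 1 − x| ≤ x²`: `‖X − 1‖ ≤ (1 + ‖log X‖)‖log X‖`),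
  `mean_le`, `norm_le_of_two_anchors`.
* §2 `dist1_rect_le_sq_mul` (`PlaqSmall θ U ⟹ dist1 U(∂□_L(x)) ≤ L²θ`), `sq_L_le_quarter`, ★`memberWord_eq_conj_rect` — the member word at the chain indices `i, τ i, τ i, i` in ✓G9's
  conjugated slots IS `U(Γ^σ)·rect U x_r μ ν L L·U(Γ^σ)⁻¹` (✓G9 `word_conj_rewrite` backwards + ✓p817168 `chainWord_eq_conj_rect`).

HONEST SCOPE.  Elementary Banach-algebra and lattice bookkeeping; nothing of Bałaban's renormalisation analysis; the (C)-STEP itself is the sibling `…S2BetaOneLevelStep`; KEY LEMMA,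
`hFlat`, TUBE-REG∘, GAP♯∘, S2β, crux 20520 and `YM3TorusSU2` are NOT proved; no registered stub is closed; the Yang–Mills mass gap is NOT proved.
References: T. Bałaban, CMP **109** (1987) 249–301 [Balaban1987RG1] ((0.4) p.253); CMP **98** (1985) 17–51 [Balaban1985Averaging] ((19)–(20) p.21, (26)–(27) p.22).
-/

set_option autoImplicit false

noncomputable section

namespace Summit.QuantumFields.YangMills.Theorems.FluctuationComparisonRegPrIntLS2BetaOneLevelStepLetters

open NormedSpace Finset
open scoped BigOperators Matrix.Norms.L2Operator
open Literature.MathematicalPhysics.QuantumFieldTheory.Balaban1983to89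
open Literature.MathematicalPhysics.QuantumFieldTheory.Balaban1983to89.T4Continuum
open Literature.MathematicalPhysics.QuantumFieldTheory.Balaban1983to89.AveragingRT
open Literature.MathematicalPhysics.QuantumFieldTheory.Balaban1983to89.BlockAveraging
open Literature.MathematicalPhysics.QuantumFieldTheory.Balaban1983to89.MatrixLog (mlog exp_mlog norm_mlog_le_div norm_mlog_le_two_mul
  norm_sub_one_le_exp_norm_mlog_sub_one)
open Literature.MathematicalPhysics.QuantumFieldTheory.Balaban1983to89.ExpMeanLog (eml eml_eq_exp ESU coe_ESU_of_small expMeanLogSU deltaSU mlog_conj)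
open Literature.MathematicalPhysics.QuantumFieldTheory.Balaban1983to89.LatticeWordStokes (dist1_loopHol_le small_of_plaqSmall)
open B10Eq47AxialChi (shiftN rect plaqSmall_axialAvg)

variable {n : Type*} [Fintype n] [DecidableEq n] [Nonempty n]
variable {P : Params} {j : ℕ}

/-! ## §1 Bridges: the small-loop average as `exp[mean log]`; nested means; the log of a unitary conjugate -/

/-- **THE RECORD's AVERAGE IS `exp[mean log]` ON THE GUARD** (lit `coe_ESU_of_small` ∕ `eml_eq_exp`, through the fixed enumeration of `LoopAverage.avg`): for an
`SU(N)`-family with `dist1 (W i) < δ_N`, `(expMeanLogSU.avg W : M_N) = exp(|I|⁻¹ • Σ_i log (W i))` with the REAL scalar `|I|⁻¹`. [cite: Balaban1987RG1, (0.4) p.253] -/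
theorem coe_avg_eq_exp_mean {ι : Type*} [Fintype ι] [Nonempty ι] (W : ι → Matrix.specialUnitaryGroup n ℂ)
    (hW : ∀ i, dist1 (W i) < deltaSU n) :
    (((expMeanLogSU (n := n)).avg W : Matrix.specialUnitaryGroup n ℂ) : Matrix n n ℂ) =
      exp (((Fintype.card ι : ℝ))⁻¹ • ∑ i, mlog (W i : Matrix n n ℂ)) := by
  unfold LoopAverage.avg
  have hg : ∀ k, ‖((W ∘ (LoopAverage.enum ι).symm) k : Matrix n n ℂ) - 1‖ < deltaSU n := fun k => hW _
  show ((ESU (W ∘ (LoopAverage.enum ι).symm) : Matrix.specialUnitaryGroup n ℂ) : Matrix n n ℂ) = _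
  rw [coe_ESU_of_small hg, eml_eq_exp]
  congr 1
  have hcard : (Fintype.card (Fin (Fintype.card ι - 1 + 1)) : ℂ) = (Fintype.card ι : ℂ) := by
    rw [Fintype.card_fin, Nat.sub_add_cancel Fintype.card_pos]
  have hsum : ∑ k : Fin (Fintype.card ι - 1 + 1), mlog (((W ∘ (LoopAverage.enum ι).symm) k : Matrix.specialUnitaryGroup n ℂ) : Matrix n n ℂ) =
      ∑ i, mlog (W i : Matrix n n ℂ) :=
    Equiv.sum_comp (LoopAverage.enum ι).symm (fun i => mlog (W i : Matrix n n ℂ))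
  rw [hcard, hsum]
  have hcoe : ((Fintype.card ι : ℂ))⁻¹ = ((((Fintype.card ι : ℝ))⁻¹ : ℝ) : ℂ) := by
    rw [Complex.ofReal_inv, Complex.ofReal_natCast]
  rw [hcoe, Complex.coe_smul]

/-- **NORM OF A UNIFORM MEAN ≤ MEAN OF THE BOUNDS** (stated for a `ℂ`-normed algebra with the same instance path as ✓G10∕✓G14, so that it docks on their terms
syntactically). [folklore] -/
theorem norm_mean_le_mean {𝔸 : Type*} [NormedRing 𝔸] [NormedAlgebra ℂ 𝔸] {ι : Type*} [Fintype ι] (x : ι → 𝔸) (g : ι → ℝ)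
    (h : ∀ i, ‖x i‖ ≤ g i) : ‖((Fintype.card ι : ℝ))⁻¹ • ∑ i, x i‖ ≤ ((Fintype.card ι : ℝ))⁻¹ * ∑ i, g i := by
  rw [norm_smul, Real.norm_eq_abs, abs_of_nonneg (inv_nonneg.mpr (Nat.cast_nonneg _))]
  exact mul_le_mul_of_nonneg_left ((norm_sum_le _ _).trans (Finset.sum_le_sum fun i _ => h i)) (inv_nonneg.mpr (Nat.cast_nonneg _))

omit [Nonempty n] in
/-- **THE LOG OF A UNITARY CONJUGATE HAS THE SAME NORM**: `‖log (S X S⁻¹)‖ = ‖log X‖` for `S ∈ SU(N)` (lit `mlog_conj` + the `C⋆`-property of the operator norm). [cite: Balaban1985Averaging, (20) p.21] -/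
theorem norm_mlog_conj_eq (S : Matrix.specialUnitaryGroup n ℂ) (X : Matrix n n ℂ) :
    ‖mlog ((S : Matrix n n ℂ) * X * ((S⁻¹ : Matrix.specialUnitaryGroup n ℂ) : Matrix n n ℂ))‖ = ‖mlog X‖ := by
  have hS : (S : Matrix n n ℂ) ∈ Matrix.unitaryGroup n ℂ := Matrix.specialUnitaryGroup_le_unitaryGroup S.2
  have hSi : ((S⁻¹ : Matrix.specialUnitaryGroup n ℂ) : Matrix n n ℂ) ∈ Matrix.unitaryGroup n ℂ :=
    Matrix.specialUnitaryGroup_le_unitaryGroup (S⁻¹).2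
  have h1 : (S : Matrix n n ℂ) * ((S⁻¹ : Matrix.specialUnitaryGroup n ℂ) : Matrix n n ℂ) = 1 := by
    rw [← Submonoid.coe_mul, mul_inv_cancel]; rfl
  have h2 : ((S⁻¹ : Matrix.specialUnitaryGroup n ℂ) : Matrix n n ℂ) * (S : Matrix n n ℂ) = 1 := by
    rw [← Submonoid.coe_mul, inv_mul_cancel]; rfl
  rw [mlog_conj h1 h2, CStarRing.norm_mul_mem_unitary _ hSi, CStarRing.norm_mem_unitary_mul _ hS]

/-- `x ∕ (1 − x) ≤ (1 + 2X)·x` for `0 ≤ x ≤ X ≤ 1∕2`. [folklore] -/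
theorem div_one_sub_le {x X : ℝ} (hx : 0 ≤ x) (hxX : x ≤ X) (hX : X ≤ 1 / 2) : x / (1 - x) ≤ (1 + 2 * X) * x := by
  rw [div_le_iff₀ (by linarith)]
  nlinarith [mul_nonneg hx (sub_nonneg.mpr hxX), mul_nonneg hx (by linarith : 0 ≤ 1 - 2 * X)]

/-- **`‖log X‖ ≤ (1 + 2t)·‖X − 1‖`** for `‖X − 1‖ ≤ t ≤ 1∕2` (lit (26) `‖log X‖ ≤ ‖X−1‖∕(1 − ‖X−1‖)`): the `dist1 → log` conversion costs a factor `1 + O(t)`, NOT `π∕2`.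
[cite: Balaban1985Averaging, (26) p.22] -/
theorem norm_mlog_le_one_add_mul {𝔸 : Type*} [NormedRing 𝔸] [NormedAlgebra ℂ 𝔸] [CompleteSpace 𝔸] {X : 𝔸} {t : ℝ} (hX : ‖X - 1‖ ≤ t) (ht : t ≤ 1 / 2) :
    ‖mlog X‖ ≤ (1 + 2 * t) * ‖X - 1‖ :=
  (norm_mlog_le_div (hX.trans_lt (by linarith))).trans (div_one_sub_le (norm_nonneg _) hX ht)

/-- **`‖X − 1‖ ≤ (1 + m)·m` for `m = ‖log X‖ ≤ 1`**, `‖X − 1‖ < 1` (lit (27) `‖X − 1‖ ≤ e^{‖log X‖} − 1` and Mathlib `|eˣ − 1 − x| ≤ x²`): the `log → dist1` conversion costs `1 + O(m)`.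
[cite: Balaban1985Averaging, (27) p.22] -/
theorem norm_sub_one_le_one_add_mul {𝔸 : Type*} [NormedRing 𝔸] [NormedAlgebra ℂ 𝔸] [CompleteSpace 𝔸] {X : 𝔸} (hX : ‖X - 1‖ < 1) (hm : ‖mlog X‖ ≤ 1) :
    ‖X - 1‖ ≤ (1 + ‖mlog X‖) * ‖mlog X‖ := by
  have h1 := norm_sub_one_le_exp_norm_mlog_sub_one hX
  have h2 := Real.abs_exp_sub_one_sub_id_le (x := ‖mlog X‖) (by rw [abs_of_nonneg (norm_nonneg _)]; exact hm)
  have h3 : Real.exp ‖mlog X‖ - 1 ≤ ‖mlog X‖ + ‖mlog X‖ ^ 2 := by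
    have := (abs_le.mp h2).2; linarith
  nlinarith [norm_nonneg (mlog X)]

/-- A uniform mean of reals bounded by `b` is bounded by `b`. [folklore] -/
theorem mean_le {ι : Type*} [Fintype ι] [Nonempty ι] (f : ι → ℝ) {b : ℝ} (hf : ∀ i, f i ≤ b) :
    ((Fintype.card ι : ℝ))⁻¹ * ∑ i, f i ≤ b := by
  have hc : (0 : ℝ) < Fintype.card ι := Nat.cast_pos.mpr Fintype.card_pos
  rw [inv_mul_le_iff₀ hc]
  calc ∑ i, f i ≤ ∑ _i : ι, b := Finset.sum_le_sum fun i _ => hf i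
    _ = (Fintype.card ι : ℝ) * b := by rw [Finset.sum_const, Finset.card_univ, nsmul_eq_mul]

/-- `‖X − Y‖ ≤ α`, `‖Z − Y‖ ≤ β`, `‖Z‖ ≤ γ` ⟹ `‖X‖ ≤ α + β + γ`. [folklore] -/
theorem norm_le_of_two_anchors {V : Type*} [SeminormedAddCommGroup V] {X Y Z : V} {α β γ : ℝ} (h1 : ‖X - Y‖ ≤ α) (h2 : ‖Z - Y‖ ≤ β)
    (h3 : ‖Z‖ ≤ γ) : ‖X‖ ≤ α + β + γ := by
  have e : X = (X - Y) + ((Y - Z) + Z) := by abel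
  calc ‖X‖ = ‖(X - Y) + ((Y - Z) + Z)‖ := by rw [← e]
    _ ≤ ‖X - Y‖ + (‖Y - Z‖ + ‖Z‖) := (norm_add_le _ _).trans (add_le_add le_rfl (norm_add_le _ _))
    _ ≤ α + (β + γ) := add_le_add h1 (add_le_add (by rw [norm_sub_rev]; exact h2) h3)
    _ = α + β + γ := by ring

/-! ## §2 Sizes: the square at a corner, the context, member logs; the member word at the chain indices -/

variable {G : Type*} [GaugeGroup G]

/-- Under `PlaqSmall θ U` every `L × L` square loop is within `L²θ` of `1` (Stokes in squares, constant one). [cite: Balaban1985Averaging, (19) p.21] -/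
theorem dist1_rect_le_sq_mul (U : GaugeField P j G) {θ : ℝ} (hU : PlaqSmall θ U) (x : Site P j) {μ ν : Fin P.d} (h : μ < ν) :
    dist1 (rect U x μ ν P.L P.L) ≤ (P.L : ℝ) ^ 2 * θ := by
  refine (FluctuationComparisonRegPrIntLS2BetaCoupledWordSquare.dist1_rect_le_sum_square U x h).trans ?_
  calc ∑ a ∈ range P.L, ∑ b ∈ range P.L, dist1 (GaugeField.plaqHol U ⟨shiftN (shiftN x μ a) ν b, μ, ν, h⟩)
      ≤ ∑ _a ∈ range P.L, ∑ _b ∈ range P.L, θ := Finset.sum_le_sum fun a _ => Finset.sum_le_sum fun b _ => (hU _).le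
    _ = (P.L : ℝ) ^ 2 * θ := by simp only [Finset.sum_const, Finset.card_range, nsmul_eq_mul]; ring

/-- `L² ≤ ((d+2)L)²∕4` (`d ≥ 1`): the square threshold `L²θ` is below the member size `τ = ((d+2)L)²∕4·θ`. [folklore] -/
theorem sq_L_le_quarter (P : Params) : (P.L : ℝ) ^ 2 ≤ (((P.d + 2) * P.L : ℕ) : ℝ) ^ 2 / 4 := by
  have hd : (1 : ℝ) ≤ P.d := by exact_mod_cast P.hd
  have hL : (0 : ℝ) ≤ P.L := Nat.cast_nonneg _
  push_cast
  nlinarith [mul_nonneg hL hL, sq_nonneg ((P.d : ℝ) * P.L)]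

/-- **THE MEMBER WORD AT THE CHAIN INDICES, in ✓G9's conjugated slots, IS THE CONJUGATED SHARP SQUARE**: with `ℓ_m = loopHol U c_m`, `A_m = axialAvg U c_m`,
`P₃ = A₁A₂A₃⁻¹`, `H₀ = A₁A₂A₃⁻¹A₄⁻¹` and `τ i = (r, σ′, σ)`:
`ℓ₁ i · (A₁ ℓ₂(τ i) A₁⁻¹) · (P₃ ℓ₃(τ i)⁻¹ P₃⁻¹) · (H₀ ℓ₄ i⁻¹ H₀⁻¹) · H₀ = U(Γ^σ)·rect U x_r μ ν L L·U(Γ^σ)⁻¹` (✓G9 `word_conj_rewrite` backwards + ✓FILE 1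
`chainWord_eq_conj_rect`). [cite: Balaban1987RG1, (0.4) p.253] -/
theorem memberWord_eq_conj_rect (hj : j + 1 ≤ P.m + P.K) (U : GaugeField P j G) (Q : Plaq P (j + 1)) (i : Idx P) :
    loopHol U ⟨Q.src, Q.μ⟩ i *
        (axialAvg U ⟨Q.src, Q.μ⟩ * loopHol U ⟨Q.src.shift Q.μ, Q.ν⟩ (i.1, i.2.2, i.2.1) * (axialAvg U ⟨Q.src, Q.μ⟩)⁻¹) *
        ((axialAvg U ⟨Q.src, Q.μ⟩ * axialAvg U ⟨Q.src.shift Q.μ, Q.ν⟩ * (axialAvg U ⟨Q.src.shift Q.ν, Q.μ⟩)⁻¹) *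
          (loopHol U ⟨Q.src.shift Q.ν, Q.μ⟩ (i.1, i.2.2, i.2.1))⁻¹ *
          (axialAvg U ⟨Q.src, Q.μ⟩ * axialAvg U ⟨Q.src.shift Q.μ, Q.ν⟩ * (axialAvg U ⟨Q.src.shift Q.ν, Q.μ⟩)⁻¹)⁻¹) *
        ((axialAvg U ⟨Q.src, Q.μ⟩ * axialAvg U ⟨Q.src.shift Q.μ, Q.ν⟩ * (axialAvg U ⟨Q.src.shift Q.ν, Q.μ⟩)⁻¹ * (axialAvg U ⟨Q.src, Q.ν⟩)⁻¹) *
          (loopHol U ⟨Q.src, Q.ν⟩ i)⁻¹ *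
          (axialAvg U ⟨Q.src, Q.μ⟩ * axialAvg U ⟨Q.src.shift Q.μ, Q.ν⟩ * (axialAvg U ⟨Q.src.shift Q.ν, Q.μ⟩)⁻¹ * (axialAvg U ⟨Q.src, Q.ν⟩)⁻¹)⁻¹) *
        (axialAvg U ⟨Q.src, Q.μ⟩ * axialAvg U ⟨Q.src.shift Q.μ, Q.ν⟩ * (axialAvg U ⟨Q.src.shift Q.ν, Q.μ⟩)⁻¹ * (axialAvg U ⟨Q.src, Q.ν⟩)⁻¹) =
      holAt U (walk (emb Q.src) (stairWord i.2.1 (off i.1))) * rect U (Site.blockSite Q.src i.1) Q.μ Q.ν P.L P.L *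
        (holAt U (walk (emb Q.src) (stairWord i.2.1 (off i.1))))⁻¹ :=
  (FluctuationComparisonRegPrIntLS2BetaPlaquetteWordLoopForm.word_conj_rewrite _ _ _ _ _ _ _ _).symm.trans
    (FluctuationComparisonRegPrIntLS2BetaCoupledWordSquare.chainWord_eq_conj_rect hj U Q i)

end Summit.QuantumFields.YangMills.Theorems.FluctuationComparisonRegPrIntLS2BetaOneLevelStepLetters

end
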